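import Literature.IUT.HodgeTheaters.InitialThetaDataArrowOpenProofs
import Literature.IUT.HodgeTheaters.PiAvatarToFlStar
import HarnessLib

/-!
# [IUTchI] Def 6.1 (ii) in the embedded Π-avatar: the overgroup `Π_{X_K} ⊇ Π_{X̲→_K}` is stable under `N(Π_{X̲→_K})` (proof-only)

S. Mochizuki, *Inter-universal Teichmüller theory I*, kurims manuscript (May 2020), Def. 6.1 (ii) p. 156
("if `v ∈ V^non`, then `π₁(†𝒟_v)` determines, in a functorial fashion, a topological … group corresponding to
`X_v` [cf. Corollary 1.2 if `v ∈ V^good` …], which contains `π₁(†𝒟_v)` as an open subgroup; thus, if we write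
`†𝒟_v^±` for `ℬ(−)⁰` of this topological group, then we obtain a natural morphism `†𝒟_v → †𝒟_v^±`"),
Def. 3.1 (d) p. 62 (`C_K := C_F ×_F K`, `X_K := X_F ×_F K`), Cor. 1.2 p. 39 ([IUTchI] Def 6.1 (ii) p.156)
[claim: Mochizuki2012, status: disputed] (D-0012 claim key, series status DISPUTED — this file is elementary group
theory over abc-iut-L5-t2's `InitialThetaData`; nothing of the series is asserted; no side taken on [IUTchIII] Cor. 3.12).

WHAT THIS GIVES THE D13 Π-AVATAR (abc-iut-L5-t4, KIT-INSTANCE-SPEC P5, slot `pmObj`/`toPM`, embedded design D1: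
objects = conjugates `a·Π_{X̲→_K}·a⁻¹` inside one ambient `A = Π_{C_F}`; `pmObj (a·Π_{X̲→}·a⁻¹) := a·Π_{X_K}·a⁻¹`
must not depend on the choice of `a`, i.e. on `a` modulo `N_A(Π_{X̲→_K})`).  In print this independence is the
CHARACTERISTIC nature of the coverings (Cor. 1.2, an anabelian statement over abstract groups).  In the
EMBEDDED avatar it is ELEMENTARY and proved here unconditionally (abc-iut-L5-t1, interface owner of §1):

* `ovg_conj_smul_inf_comap_eq_of_map_eq` (abstract): for `f : Π → G`, `N ⊴ Π`, `H ≤ G` and any `S ≤ Π` with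
  `f(S) = H`, every `a ∈ N_Π(S)` satisfies `a·(N ∩ f⁻¹H)·a⁻¹ = N ∩ f⁻¹H` (`f(a)` normalises `f(S) = H`);
* at the datum: `Π_{X_K} = Π_{X_F} ∩ augGF⁻¹(G_K)` with `Π_{X_F} ⊴ Π_{C_F}` (Def. 3.1 (b)) and
  `augGF(Π_{X̲→_K}) = G_K` (`Π_{X̲→} ↠ G_k`, §1 p. 38 — abc-iut-L5-t1's `aug_piXarrow_surjective`, transported by
  abc-iut-L5-t2) ⇒ **`conj_smul_PiXK_eq_of_mem_normalizer_PiXarrow`**: `a·Π_{X_K}·a⁻¹ = Π_{X_K}` for every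
  `a ∈ N_{Π_{C_F}}(Π_{X̲→_K})`, i.e. `N(Π_{X̲→_K}) ≤ N(Π_{X_K})` (the analogue for the global object
  `𝒟^{⊚±} = ℬ(Π_{X̲_K})⁰` is abc-iut-L5-t4's `normalizer_PiXund_le_normalizer_PiXK`, p425994, reused), for `Π_{C_K}`,
  and the LOCAL form at a decomposition group
  `G_v ≤ G_F`: `a·(Π_{X_K} ∩ augGF⁻¹ G_v)·a⁻¹ = Π_{X_K} ∩ augGF⁻¹ G_v` for `a ∈ N(Π_{X̲→_K} ∩ augGF⁻¹ G_v)`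
  (`conj_smul_PiXK_inf_comap_eq`) — so `pmObj` is well defined on every `†𝒟_v ≅ 𝒟_v`, with
  `π₁(†𝒟_v) ≤ pmObj` (`PiXarrow_le_PiXK`, abc-iut-L5-t2) — WITHOUT the Cor. 1.2 predicate.
PROOF-ONLY (0 defs); axioms standard.
-/

namespace Literature.IUT.HodgeTheaters

open scoped Pointwise

/-! ### Abstract group theory -/

section Abstract

variable {P Q : Type*} [Group P] [Group Q]

/-- Conjugation commutes with pull-back: `a·f⁻¹(H)·a⁻¹ = f⁻¹(f(a)·H·f(a)⁻¹)`. [folklore] -/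
private theorem ovg_conj_smul_comap_eq (f : P →* Q) (H : Subgroup Q) (a : P) :
    MulAut.conj a • H.comap f = (MulAut.conj (f a) • H).comap f := by
  ext x
  rw [Subgroup.mem_pointwise_smul_iff_inv_smul_mem, Subgroup.mem_comap, Subgroup.mem_comap,
    Subgroup.mem_pointwise_smul_iff_inv_smul_mem, MulAut.smul_def, MulAut.conj_inv_apply, MulAut.smul_def,
    MulAut.conj_inv_apply, map_mul, map_mul, map_inv]

/-- If `f(S) = H` and `b` normalises `S`, then `f(b)·H·f(b)⁻¹ ≤ H`. [folklore] -/
private theorem ovg_conj_smul_le_of_map_eq (f : P →* Q) {S : Subgroup P} {H : Subgroup Q} (hS : S.map f = H)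
    {b : P} (hb : b ∈ Subgroup.normalizer (S : Set P)) : MulAut.conj (f b) • H ≤ H := by
  intro x hx
  rw [Subgroup.mem_pointwise_smul_iff_inv_smul_mem, ← hS] at hx
  obtain ⟨s, hs, hsx⟩ := hx
  rw [← hS]
  refine ⟨b * s * b⁻¹, (Subgroup.mem_set_normalizer_iff.mp hb s).mp hs, ?_⟩
  rw [MulAut.smul_def, MulAut.conj_inv_apply] at hsx
  rw [map_mul, map_mul, map_inv, hsx]
  group

/-- If `f(S) = H` and `a` normalises `S`, then `f(a)` normalises `H`: `f(a)·H·f(a)⁻¹ = H`. [folklore] -/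
private theorem ovg_conj_smul_eq_of_map_eq (f : P →* Q) {S : Subgroup P} {H : Subgroup Q} (hS : S.map f = H)
    {a : P} (ha : a ∈ Subgroup.normalizer (S : Set P)) : MulAut.conj (f a) • H = H := by
  refine le_antisymm (ovg_conj_smul_le_of_map_eq f hS ha) fun x hx => ?_
  have h' := ovg_conj_smul_le_of_map_eq f hS ((Subgroup.normalizer (S : Set P)).inv_mem ha)
  have hx' : (MulAut.conj (f a))⁻¹ • x ∈ H := by
    refine h' ?_
    rw [map_inv, map_inv]
    exact Subgroup.smul_mem_pointwise_smul _ _ _ hx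
  exact Subgroup.mem_pointwise_smul_iff_inv_smul_mem.mpr hx'

/-- **Overgroup stability (abstract form).** `N ⊴ P`, `H ≤ G`, `f : Π → G`, `S ≤ Π` with `f(S) = H`: every
`a ∈ N_P(S)` normalises `N ∩ f⁻¹(H)`. [folklore] -/
private theorem ovg_conj_smul_inf_comap_eq_of_map_eq (f : P →* Q) {N : Subgroup P} (hN : N.Normal) (H : Subgroup Q)
    {S : Subgroup P} (hS : S.map f = H) {a : P} (ha : a ∈ Subgroup.normalizer (S : Set P)) :
    MulAut.conj a • (N ⊓ H.comap f) = N ⊓ H.comap f := by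
  rw [Subgroup.smul_inf, ovg_conj_smul_comap_eq, ovg_conj_smul_eq_of_map_eq f hS ha]
  congr 1
  ext x
  rw [Subgroup.mem_pointwise_smul_iff_inv_smul_mem, MulAut.smul_def, MulAut.conj_inv_apply]
  constructor
  · intro h
    have := hN.conj_mem _ h a
    rwa [← mul_assoc, ← mul_assoc, mul_inv_cancel, one_mul, mul_inv_cancel_right] at this
  · intro h
    have := hN.conj_mem _ h a⁻¹
    rwa [inv_inv] at this

/-- From `a·T·a⁻¹ = T` to membership in the normaliser. [folklore] -/
private theorem ovg_mem_normalizer_of_conj_smul_eq {T : Subgroup P} {a : P} (h : MulAut.conj a • T = T) :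
    a ∈ Subgroup.normalizer (T : Set P) := by
  rw [Subgroup.mem_set_normalizer_iff]
  intro x
  rw [SetLike.mem_coe, SetLike.mem_coe, ← MulAut.conj_apply, ← MulAut.smul_def,
    ← Subgroup.smul_mem_pointwise_smul_iff (a := MulAut.conj a), h]

/-- `f(S ∩ f⁻¹T) = f(S) ∩ T`. [folklore] -/
private theorem ovg_map_inf_comap_eq (f : P →* Q) (S : Subgroup P) (T : Subgroup Q) :
    (S ⊓ T.comap f).map f = S.map f ⊓ T := by
  refine le_antisymm (le_inf (Subgroup.map_mono inf_le_left) (Subgroup.map_le_iff_le_comap.mpr inf_le_right))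
    ?_
  rintro y ⟨⟨s, hs, rfl⟩, hy⟩
  exact ⟨s, ⟨hs, hy⟩, rfl⟩

end Abstract

/-! ### At the initial Θ-data -/

section Datum

universe u v w

variable {F : Type u} {K : Type v} {Fbar : Type w} [Field F] [NumberField F] [Field K] [NumberField K]
  [Algebra F K] [Field Fbar] [Algebra F Fbar] [Algebra K Fbar]
  {E : WeierstrassCurve F} [E.IsElliptic] {l : ℕ} {Pb : BadPlacePredicates K}
  (D : InitialThetaData F K Fbar E l Pb)

namespace InitialThetaData

/-- `Π_{X_K} = Π_{X_F} ∩ augGF⁻¹(G_K)`. ([IUTchI] Def 3.1(d) p.62) [claim: Mochizuki2012, status: disputed] -/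
theorem PiXK_eq_inf_comap_augGF : D.PiXK = D.geom.PiX ⊓ (galoisSubgroupOf F K Fbar).comap D.augGF := by
  rw [InitialThetaData.PiXK, PiCK_eq_comap_augGF]

/-- `augGF(Π_{X̲→_K}) = G_K` (`Π_{X̲→} ↠ G_k`, §1 p. 38; `≤` since `Π_{X̲→_K} ⊆ Π_{C_K}`).
([IUTchI] §1 p.38) [claim: Mochizuki2012, status: disputed] -/
theorem map_augGF_PiXarrow : D.PiXarrow.map D.augGF = galoisSubgroupOf F K Fbar := by
  refine le_antisymm ?_ D.galoisSubgroupOf_le_map_PiXarrow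
  rw [Subgroup.map_le_iff_le_comap, ← PiCK_eq_comap_augGF]
  exact D.PiXarrow_le_PiCK

/-- **The normaliser of `Π_{X̲→_K}` stabilises `Π_{C_K}`**: `a·Π_{C_K}·a⁻¹ = Π_{C_K}` for `a ∈ N_{Π_{C_F}}(Π_{X̲→_K})`
(`augGF(a)` normalises `G_K`). ([IUTchI] Def 6.1 (ii) p.156) [claim: Mochizuki2012, status: disputed] -/
theorem conj_smul_PiCK_eq_of_mem_normalizer_PiXarrow {a : D.PiC}
    (ha : a ∈ Subgroup.normalizer (D.PiXarrow : Set D.PiC)) : MulAut.conj a • D.PiCK = D.PiCK := by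
  rw [PiCK_eq_comap_augGF, ovg_conj_smul_comap_eq, ovg_conj_smul_eq_of_map_eq D.augGF D.map_augGF_PiXarrow ha]

/-- **Def. 6.1 (ii), embedded form: the overgroup `Π_{X_K} ⊇ Π_{X̲→_K}` is stable under every `a ∈ Π_{C_F}`
normalising `Π_{X̲→_K}`**: `a·Π_{X_K}·a⁻¹ = Π_{X_K}`.  Hence `a·Π_{X̲→_K}·a⁻¹ ↦ a·Π_{X_K}·a⁻¹` is well
defined on the isomorphs of `𝒟_v̲ = ℬ(Π_{X̲→})⁰` inside the ambient (the `pmObj` of the Π-avatar) — no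
anabelian input needed. ([IUTchI] Def 6.1 (ii) p.156) [claim: Mochizuki2012, status: disputed] -/
theorem conj_smul_PiXK_eq_of_mem_normalizer_PiXarrow {a : D.PiC}
    (ha : a ∈ Subgroup.normalizer (D.PiXarrow : Set D.PiC)) : MulAut.conj a • D.PiXK = D.PiXK := by
  rw [PiXK_eq_inf_comap_augGF]
  exact ovg_conj_smul_inf_comap_eq_of_map_eq D.augGF D.geom.PiX_normal _ D.map_augGF_PiXarrow ha

/-- `N_{Π_{C_F}}(Π_{X̲→_K}) ≤ N_{Π_{C_F}}(Π_{X_K})`. ([IUTchI] Def 6.1 (ii) p.156) [claim: Mochizuki2012, status: disputed] -/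
theorem normalizer_PiXarrow_le_normalizer_PiXK :
    Subgroup.normalizer (D.PiXarrow : Set D.PiC) ≤ Subgroup.normalizer (D.PiXK : Set D.PiC) := fun _ ha =>
  ovg_mem_normalizer_of_conj_smul_eq (D.conj_smul_PiXK_eq_of_mem_normalizer_PiXarrow ha)

/-- **LOCAL form at a decomposition group `G_v ≤ G_F`** (the objects `Π_v̲ = Π_{X̲→_K} ∩ augGF⁻¹ G_v` of
the Π-avatar at good `v̲`, and their overgroups `Π_{X_K} ∩ augGF⁻¹ G_v` "corresponding to `X_v`"):
`a·(Π_{X_K} ∩ augGF⁻¹ G_v)·a⁻¹ = Π_{X_K} ∩ augGF⁻¹ G_v` for every `a` normalising `Π_{X̲→_K} ∩ augGF⁻¹ G_v`.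
([IUTchI] Def 6.1 (ii) p.156) [claim: Mochizuki2012, status: disputed] -/
theorem conj_smul_PiXK_inf_comap_eq (Gv : Subgroup (Fbar ≃ₐ[F] Fbar)) {a : D.PiC}
    (ha : a ∈ Subgroup.normalizer ((D.PiXarrow ⊓ Gv.comap D.augGF : Subgroup D.PiC) : Set D.PiC)) :
    MulAut.conj a • (D.PiXK ⊓ Gv.comap D.augGF) = D.PiXK ⊓ Gv.comap D.augGF := by
  have hS : (D.PiXarrow ⊓ Gv.comap D.augGF).map D.augGF = galoisSubgroupOf F K Fbar ⊓ Gv := by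
    rw [ovg_map_inf_comap_eq, map_augGF_PiXarrow]
  have e : D.PiXK ⊓ Gv.comap D.augGF = D.geom.PiX ⊓ (galoisSubgroupOf F K Fbar ⊓ Gv).comap D.augGF := by
    rw [PiXK_eq_inf_comap_augGF, Subgroup.comap_inf, inf_assoc]
  rw [e]
  exact ovg_conj_smul_inf_comap_eq_of_map_eq D.augGF D.geom.PiX_normal _ hS ha

/-- Local normaliser inclusion: `N(Π_{X̲→_K} ∩ augGF⁻¹ G_v) ≤ N(Π_{X_K} ∩ augGF⁻¹ G_v)`.
([IUTchI] Def 6.1 (ii) p.156) [claim: Mochizuki2012, status: disputed] -/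
theorem normalizer_PiXarrow_inf_le (Gv : Subgroup (Fbar ≃ₐ[F] Fbar)) :
    Subgroup.normalizer ((D.PiXarrow ⊓ Gv.comap D.augGF : Subgroup D.PiC) : Set D.PiC) ≤
      Subgroup.normalizer ((D.PiXK ⊓ Gv.comap D.augGF : Subgroup D.PiC) : Set D.PiC) := fun _ ha =>
  ovg_mem_normalizer_of_conj_smul_eq (D.conj_smul_PiXK_inf_comap_eq Gv ha)

/-- The object lies in its overgroup: `Π_{X̲→_K} ∩ augGF⁻¹ G_v ≤ Π_{X_K} ∩ augGF⁻¹ G_v` ("contains `π₁(†𝒟_v)`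
as an open subgroup" — containment part). ([IUTchI] Def 6.1 (ii) p.156) [claim: Mochizuki2012, status: disputed] -/
theorem PiXarrow_inf_le_PiXK_inf (Gv : Subgroup (Fbar ≃ₐ[F] Fbar)) :
    D.PiXarrow ⊓ Gv.comap D.augGF ≤ D.PiXK ⊓ Gv.comap D.augGF :=
  inf_le_inf_right _ D.PiXarrow_le_PiXK

end InitialThetaData

end Datum

end Literature.IUT.HodgeTheaters
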